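import Summits.ABC.IUTFork.Cor312UnitCosetShellCells
import HarnessLib

/-!
# [IUTchIII] Cor. 3.12 — the COSET test model, VI-d: the HULL-class rows and the pre-hull rows at the graded-shell coset bed

Proof-only file (D-0012; no definition, no `Prop` fact, nothing asserted about print) of the abc-iut cell (wave-4 prover abc-iut-w4-d101, gen 6),
for the repair branch (rung LADDER-ABC:A2.RP; abc-iut-rp-plan FOLD #5 «NEXT: … KS(δ) cells»). TAKES NO SIDE on [IUTchIII] Cor. 3.12; candidates
are hypotheses; instantiated ≠ endorsed. The bed is `UnitCosetShell.ksSetting p δ` (p444365) — bed K with the typed log-shell `𝓘_j = p^{−δ_j}𝒪` —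
read by `UnitCoset.cosetRegion` / `UnitCoset.idealDatum`. Since no row below reads the typed log-shell, bed K's cells (`Cor312UnitCosetCoarseCells`,
p441461) transfer verbatim to EVERY depth `δ`, in particular to the THRESHOLD bed `δ⋆` where print's (Ind3)-containers reading RP-I05 ∧ RP-I05c ∧
RP-I06 ∧ RP-I06⋆ also holds (`Cor312UnitCosetShellCells.containers_dStar`, p445248):
* RP-M04b `CandMochizuki4.H'` ✓ · RP-X01b `CandExplicit1.H_Englf` ✓ · RP-M32c `CandMochizuki32.H''` ✓ · RP-M36b `CandMochizuki6.H'` ✓ for the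
  saturation «coarse holomorphic hull», ✗ for `sat = id` — the HULL class is SAT+ on a MOVING, j²-exact, KummerB-honest bed that ALSO carries the
  containers reading, still with ¬S ∀ q-pinned q-data;
* the X04a-shape containment «q-region ⊆ (Ind3)-union of the Θ-images» ✗ at every label of `𝔽_l^⋇`;
* `threshold_rows` — the package at `p = 7`, depth `δ⋆`: containers reading ∧ hull-class rows ∧ Statement WITH EQUALITY ∧ ¬S ∀ q-pinned q-data.
One place (`toyIndex`, `l⋇ = 2`); a model of the typed interface, not of initial Θ-data; no judgement on print or on any author.
[claim: Mochizuki2012, status: disputed] [cite: ScholzeStix2018, §2.2 pp. 9–10]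
-/

noncomputable section

namespace Summit.ABC.IUTFork.Cor312Vol.UnitCosetShell

open Set Cor312 Cor312.Checks Cor312.IdentifiedNonVacuity NaiveWitness PinnedWitness PinnedHonest UnitWitness UnitCoset UnitCosetCoarse
  Repair.CandInternal2 Literature.IUT.LogThetaLattice
open Thm311 hiding toyIndex

variable (p : ℕ) [hp : Fact p.Prime] (δ : toyIndex.Label → ℕ)

/-- **RP-M04b `CandMochizuki4.H'` HOLDS** at the bed, every depth. [folklore] -/
theorem m04b_at_ksSetting : Repair.CandMochizuki4.H' (ksFull p δ).toLatticeSituation (ksSetting p δ) (cosetRegion p) (idealDatum p) :=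
  fun _ i vQ => by rw [cosetRegion_idealDatum p (Setting.labelSucc_ne_zero i), ksSetting_thetaHull p δ (Setting.labelSucc_ne_zero i)]

/-- **RP-X01b `CandExplicit1.H_Englf` HOLDS** at the bed (it is `PilotKummerCompatHull` given the link pin), every depth. [folklore] -/
theorem x01b_at_ksSetting : Repair.CandExplicit1.H_Englf (ksFull p δ).toLatticeSituation (ksSetting p δ) (cosetRegion p) (idealDatum p) :=
  fun _ => ksSetting_pilotKummerCompatHull p δ

/-- The q-region lies in the hull at EVERY label (zero label included), every depth. [folklore] -/
theorem ksSetting_qRegion_subset_thetaHull (j : toyIndex.Label) (vQ : toyIndex.VQ) :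
    (ksSetting p δ).qRegion j vQ ⊆ (ksSetting p δ).thetaHull j vQ := by
  by_cases hj : j = 0
  · subst hj; rw [ksSetting_qRegion_zero, ksSetting_thetaHull_zero]
  · rw [ksSetting_qRegion p δ hj, ksSetting_thetaHull p δ hj]

/-- **RP-M32c `CandMochizuki32.H''` HOLDS** at the bed (the first arrow of (f^toy) at hull level, every packet), every depth. [folklore] -/
theorem m32c_at_ksSetting : Repair.CandMochizuki32.H'' (ksFull p δ).toLatticeSituation (ksSetting p δ) (cosetRegion p) (idealDatum p) :=
  fun j vQ => (Repair.CandMochizuki32.firstArrow_hull_iff (ksSetting p δ) j vQ).2 (ksSetting_qRegion_subset_thetaHull p δ j vQ)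

/-- **RP-M36b `CandMochizuki6.H'` HOLDS** at the bed for the saturation «holomorphic hull in the coarse frame», every depth. [folklore] -/
theorem m36b_hull_at_ksSetting : Repair.CandMochizuki6.H' (ksFull p δ).toLatticeSituation (ksSetting p δ) (cosetRegion p) (idealDatum p)
    (fun j vQ U => ((ksSetting p δ).frame j vQ).hull U) := by
  refine ⟨⟨fun j vQ U => ((ksSetting p δ).frame j vQ).subset_hull U,
      fun i vQ U hU => ((ksSetting p δ).frame _ vQ).hull_mono (Set.subset_sUnion_of_mem hU)⟩,
    fun i vQ => ⟨_, (ksSetting p δ).thetaRegion3_mem_possibleImages _ vQ, ?_⟩⟩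
  have hj := Setting.labelSucc_ne_zero i
  rw [cosetRegion_idealDatum p hj]
  show uBall p _ vQ 1 ⊆ (coarsePFrame p _ vQ).hull ((ksSetting p δ).thetaRegion3 (Setting.labelSucc i) vQ)
  rw [coarsePFrame_hull_eq_one p (((Set.subset_sUnion_of_mem ((ksSetting p δ).thetaRegion3_mem_possibleImages _ vQ)).trans
    (ks_sUnion_possibleImages_subset p δ hj vQ)).trans (uBall_mono p _ vQ (one_le_jsq i)))]
  exact Set.Subset.rfl

/-- … and FAILS for the identity saturation: no possible image (a moved pair `∌ 0`) contains the q-region `q𝒪 ∋ 0`. [folklore] -/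
theorem m36b_id_not_at_ksSetting : ¬ Repair.CandMochizuki6.H' (ksFull p δ).toLatticeSituation (ksSetting p δ) (cosetRegion p) (idealDatum p)
    (fun _ _ U => U) := by
  rintro ⟨-, h⟩
  obtain ⟨U, hU, hsub⟩ := h ⟨0, by decide⟩ ()
  obtain ⟨ε, hε, rfl⟩ := ks_possibleImages_subset p δ (Setting.labelSucc_ne_zero _) () hU
  rw [cosetRegion_idealDatum p (Setting.labelSucc_ne_zero _)] at hsub
  exact not_uBall_subset_pair p _ () (mul_ne_zero hε.1 (qpow_spec p _).1) 1 hsub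

/-- The X04a-shape containment «q-region ⊆ (Ind3)-union of the Θ-images» FAILS at every label of `𝔽_l^⋇`, every depth. [folklore] -/
theorem ksSetting_qRegion_not_subset_thetaRegion3 (i : Fin toyIndex.lstar) (vQ : toyIndex.VQ) :
    ¬ (ksSetting p δ).qRegion (Setting.labelSucc i) vQ ⊆ (ksSetting p δ).thetaRegion3 (Setting.labelSucc i) vQ := by
  rw [ksSetting_qRegion p δ (Setting.labelSucc_ne_zero i), ksSetting_thetaRegion3, ksSetting_thetaRegion p δ 0 (Setting.labelSucc_ne_zero i)]
  exact not_uBall_subset_pair p _ vQ (qpow_spec p _).1 1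

/-- **At the threshold bed the (Ind3)-container, the holomorphic hull and the q-pilot region COINCIDE at every label** (`B_1 = q𝒪` on `𝔽_l^⋇`,
`𝒪` at the zero label) — the normal form of print's containers reading on this carrier. [folklore] -/
theorem container_eq_hull_eq_qRegion_dStar (j : toyIndex.Label) (vQ : toyIndex.VQ) :
    (⋃ m : ℤ, cosetRegion p (shellSat (ksFull p dStar).toLatticeSituation 0 ((kColumn p 0).frobΨ m)) j vQ) = (ksSetting p dStar).thetaHull j vQ ∧
      (ksSetting p dStar).thetaHull j vQ = cosetRegion p (idealDatum p) j vQ := by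
  by_cases hj : j = 0
  · subst hj; rw [iUnion_container_zero, ksSetting_thetaHull_zero, cosetRegion_zero]; exact ⟨rfl, rfl⟩
  · rw [iUnion_container p dStar hj, ksSetting_thetaHull p dStar hj, cosetRegion_idealDatum p hj, dStar_eq hj, sub_sub_cancel]
    exact ⟨rfl, rfl⟩

/-- **THE THRESHOLD ROWS, packaged** (`p = 7`, depth `δ⋆`): print's containers reading RP-I05 ∧ RP-I05c ∧ RP-I06 ∧ RP-I06⋆ ∧ the hull-class rows
RP-M04b ∧ RP-X01b ∧ RP-M32c ∧ (∃ sat, RP-M36b) ∧ Licence ∧ Statement WITH EQUALITY ∧ [Θ-region MOVED] — with ¬S for EVERY q-pinned q-datum,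
¬`PilotKummerCompat`, the X04a-shape ✗ and RP-M36b ✗ for `sat = id`. Interface level; hypotheses are readings, not endorsements. [folklore] -/
theorem threshold_rows :
    ∃ (T : ThetaIndex) (F : FullSituation T) (P : Setting F.toLatticeSituation.toSituation)
      (ρ : (∀ v : T.V, v ∈ T.Vbad → Set (F.L.StarPacket v)) → ∀ (j : T.Label) (vQ : T.VQ), Set (F.L.Packet j vQ))
      (qK : ∀ v : T.V, v ∈ T.Vbad → Set (F.L.StarPacket v)),
      F.Statement ∧ BridgeHyps P ∧ PinnedRegions3 F.toLatticeSituation P ρ qK ∧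
      HInd3Hull F.toLatticeSituation P ρ ∧ Repair.CandInternal11.H F.toLatticeSituation P ρ ∧
      HQShellOrbit F.toLatticeSituation P ρ qK ∧ Repair.CandInternal11Gap.HQShellOrbitStar F.toLatticeSituation P ρ qK ∧
      Repair.CandMochizuki4.H' F.toLatticeSituation P ρ qK ∧ Repair.CandExplicit1.H_Englf F.toLatticeSituation P ρ qK ∧
      Repair.CandMochizuki32.H'' F.toLatticeSituation P ρ qK ∧ (∃ sat, Repair.CandMochizuki6.H' F.toLatticeSituation P ρ qK sat) ∧
      Thm311ToCor312.Licence P ∧ P.Statement ∧ P.negLogTheta = ((P.negLogQ : ℝ) : WithTop ℝ) ∧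
      (∃ (j : T.Label) (vQ : T.VQ), ∃ Φ ∈ Setting.indGroup F.toSituation,
        Φ j vQ '' P.thetaRegion3 j vQ ∈ P.possibleImages j vQ ∧ Φ j vQ '' P.thetaRegion3 j vQ ≠ P.thetaRegion3 j vQ) ∧
      (∀ qK', QPinned F.toLatticeSituation P ρ qK' → ¬ PilotKummerIndRelated F.toLatticeSituation P ρ qK') ∧
      ¬ PilotKummerCompat F.toLatticeSituation P qK ∧
      (∀ (i : Fin T.lstar) (vQ : T.VQ), ¬ P.qRegion (Setting.labelSucc i) vQ ⊆ P.thetaRegion3 (Setting.labelSucc i) vQ) ∧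
      ¬ Repair.CandMochizuki6.H' F.toLatticeSituation P ρ qK (fun _ _ U => U) := by
  haveI : Fact (Nat.Prime 7) := ⟨by norm_num⟩
  exact ⟨toyIndex, ksFull 7 dStar, ksSetting 7 dStar, cosetRegion 7, idealDatum 7, ksFull_statement 7 dStar, ksSetting_bridgeHyps 7 dStar,
    ksSetting_pinnedRegions3 7 dStar, (containers_dStar 7).1, (containers_dStar 7).2.1, (containers_dStar 7).2.2.1, (containers_dStar 7).2.2.2,
    m04b_at_ksSetting 7 dStar, x01b_at_ksSetting 7 dStar, m32c_at_ksSetting 7 dStar, ⟨_, m36b_hull_at_ksSetting 7 dStar⟩,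
    ksSetting_licence 7 dStar, ksSetting_statement 7 dStar, ksSetting_negLogTheta_eq_negLogQ 7 dStar,
    ⟨1, (), ksSetting_possibleImages_moved 7 dStar le_rfl ()⟩, fun qK' hq => ksSetting_not_pilotKummerIndRelated_of_qPinned 7 dStar qK' hq,
    ksSetting_not_pilotKummerCompat 7 dStar, ksSetting_qRegion_not_subset_thetaRegion3 7 dStar, m36b_id_not_at_ksSetting 7 dStar⟩

end Summit.ABC.IUTFork.Cor312Vol.UnitCosetShell

end
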